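import Mathlib
import HarnessLib.Audit
import Summits.PneNP.PneNP.Theorems.PstarSliceGenericInternal

/-!
# The core bound from O2 and a finite criterion: `TerminalFiveA → CleanSmallCriterionBound → TerminalFive` (ROUND-24; memo g23 §28)

FRONTIER range-avoidance ladder, rung F-N3, ROUND 24 (cell `pnp-ideate`, prover-2 memo `g23/O1-TWOCLEAN-g23.md` §28; typed targets
`PstarCoreBoundTargets.TerminalFive` / `TerminalFiveA` / `TerminalPeelable` (p646951); restricted-model proof complexity — nothing here bears on `P`
versus `NP`).

The assembly of the whole O1 side by STRONG INDUCTION on the core size.  In a putative terminal core `J₀` with a centre cycle, the clean two-chord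
theorem needs two outside-gated chords passing the criterion; branch (A) of the criterion asks that certain proper sub-families `K₀ ⊊ J₀` are not
terminal cores — and by the induction hypothesis such sub-cores have AT MOST FIVE outputs.  So only SMALL path-sum sub-cores have to be excluded:

* `NoSmallPathSumSubcore I r y J₀ c 𝒢` — `NoPathSumSubcoreLin` restricted to sub-families with `#K₀ ≤ 5` (triangle, `C₄`, `C₅`, `K₄ − e` in the XOR
  graph; a finite list of reader shapes on each);
* `CleanSmallCriterionBound` (OPEN; census-type): on every centre structure there is `ℬ ⊆ J₀` with `#ℬ + 2 ≤ #sharedSlots` such that every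
  outside-gated chord outside `ℬ` satisfies `NoSmallPathSumSubcore` and `NoShortCoincidence` for the INTERNAL menu (planner census: (B) fails at
  ≤ 2 chords of every tri/c4a structure; (A)-census of sub-cores with ≤ 5 outputs requested);
* **`terminalFive_of_bound : TerminalFiveA → CleanSmallCriterionBound → TerminalFive`** — O2 (prover-1's programme) and this one finite node give
  the full core bound, hence (`PstarCoreBoundTargets.terminalPeelable_of_terminalFive`) also O1.

No Assumption A; no genericity hypothesis (genericity is DERIVED from the criterion).
-/

set_option linter.dupNamespace false -- `Summit.PneNP.PneNP.…`: summit = sub-problem name (D-0017 single-conjunct layout)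

open Finset Literature.Computability.Complexity
open Summit.PneNP.PneNP.Theorems.PstarTyped (Typed)
open Summit.PneNP.PneNP.Theorems.PstarSALevel (varSet bdry BoundaryExpanding SimpleOverlap)
open Summit.PneNP.PneNP.Theorems.PstarXCore (xverts)
open Summit.PneNP.PneNP.Theorems.PstarCoreBound (XorClosed)
open Summit.PneNP.PneNP.Theorems.PstarChordRepair (IsChord)
open Summit.PneNP.PneNP.Theorems.PstarCoreBoundTargets (Terminal TerminalFive TerminalFiveA TerminalPeelable nonchords nonchords_subset mem_nonchords
  terminalPeelable_of_terminalFive)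
open Summit.PneNP.PneNP.Theorems.PstarSharingBound (sharedSlots)
open Summit.PneNP.PneNP.Theorems.PstarChordBridgeTools (xpdeg)
open Summit.PneNP.PneNP.Theorems.PstarChordBridgeCentre (exists_maximal_peelable_sup)
open Summit.PneNP.PneNP.Theorems.PstarGapOneAll (gval)
open Summit.PneNP.PneNP.Theorems.PstarChordReadOutside (OutsideGated)
open Summit.PneNP.PneNP.Theorems.PstarTerminalPeelableTwelve (exists_centre_of_not_peelable)
open Summit.PneNP.PneNP.Theorems.PstarChordReadTwoClean (false_of_two_clean)
open Summit.PneNP.PneNP.Theorems.PstarCleanChordCount (exists_clean_chords)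
open Summit.PneNP.PneNP.Theorems.PstarSliceGenericCriterion (NoPathSumSubcoreLin NoShortCoincidence sliceGeneric_of_criterionLin)
open Summit.PneNP.PneNP.Theorems.PstarSliceGenericInternal (internalMenu internalMenu_subset sliceGeneric_of_internal)

namespace Summit.PneNP.PneNP.Theorems.PstarTerminalFiveAssembly

variable {n m : ℕ}

/-- **BRANCH (A) FOR SMALL SUB-CORES ONLY**: `NoPathSumSubcoreLin` restricted to sub-families `K₀` of at most five outputs. -/
def NoSmallPathSumSubcore (I : LocalMap 4 n m) (r : ℕ) (y : Fin m → Bool) (J₀ : Finset (Fin m)) (c : Fin m) (𝒢 : Finset (Fin m)) : Prop :=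
  ∀ K₀ ⊆ J₀.erase c, K₀.Nonempty → XorClosed I K₀ → K₀.card ≤ 5 →
    ∀ (F₁ F₂ : Finset (Fin m)) (t : Bool) (d₁ d₂ : Finset (Fin n) × Finset (Fin m) × Bool),
      F₁ ⊆ (J₀.erase c) \ K₀ → F₂ ⊆ (J₀.erase c) \ K₀ → d₁.2.1 = F₁ → d₂.2.1 ⊆ 𝒢 ∪ F₂ → d₁ ≠ d₂ →
      (∀ v, v ∈ d₁.1 ↔ Odd (xpdeg I (insert c F₁) v)) → (∀ v ∈ d₁.1, ∃ f ∈ K₀, v ∈ varSet I f) →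
      (∀ v ∈ d₂.1, (∃ f ∈ K₀, v ∈ varSet I f) ∨ ∃ g ∈ d₁.2.1 ∪ d₂.2.1, I.vars g 2 = v ∨ I.vars g 3 = v) →
      (∀ z : Fin n → Bool, (∀ f ∈ F₁, I.eval z f = y f) →
        (gval I d₁.1 d₁.2.1 z = d₁.2.2 ↔ xor (z (I.vars c 0)) (z (I.vars c 1)) = t)) →
      ¬ Terminal I r y K₀ d₁ d₂

/-- **`CleanSmallCriterionBound` (OPEN, census-type)**: on every centre structure of a terminal core there is `ℬ ⊆ J₀`, `#ℬ + 2 ≤ #sharedSlots J₀`, such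
that every outside-gated chord of `J₀` outside `ℬ` satisfies `NoSmallPathSumSubcore` and `NoShortCoincidence` for the internal menu
`internalMenu I J₀ (G₁ ∪ G₂)`.  FRONTIER. -/
@[conjecture] def CleanSmallCriterionBound : Prop :=
  ∀ (n m r : ℕ) (I : LocalMap 4 n m), I.IsPure xorAndPred → Typed I → SimpleOverlap I → BoundaryExpanding r I →
    ∀ (y : Fin m → Bool) (J₀ : Finset (Fin m)) (w₁ w₂ : Finset (Fin n) × Finset (Fin m) × Bool), Terminal I r y J₀ w₁ w₂ →
      (∃ S ⊆ J₀, S.Nonempty ∧ (∀ w ∈ xverts I S, 2 ≤ xpdeg I S w) ∧ ∀ f ∈ S, ¬ IsChord I J₀ f) →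
      ∃ ℬ ⊆ J₀, ℬ.card + 2 ≤ (sharedSlots I J₀).card ∧
        ∀ c ∈ J₀, c ∉ ℬ → IsChord I J₀ c → OutsideGated I J₀ (w₁.2.1 ∪ w₂.2.1) c →
          NoSmallPathSumSubcore I r y J₀ c (internalMenu I J₀ (w₁.2.1 ∪ w₂.2.1)) ∧
            NoShortCoincidence I J₀ c (internalMenu I J₀ (w₁.2.1 ∪ w₂.2.1))

variable {I : LocalMap 4 n m} {r : ℕ} {y : Fin m → Bool} {J₀ 𝒢 : Finset (Fin m)} {c : Fin m}

/-- If every terminal sub-core inside `J₀ ∖ c` has at most five outputs, the small node gives the full (A)-node. -/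
theorem noPathSumSubcoreLin_of_small
    (hIH : ∀ K₀ ⊆ J₀.erase c, ∀ d₁ d₂ : Finset (Fin n) × Finset (Fin m) × Bool, Terminal I r y K₀ d₁ d₂ → K₀.card ≤ 5)
    (h : NoSmallPathSumSubcore I r y J₀ c 𝒢) : NoPathSumSubcoreLin I r y J₀ c 𝒢 :=
  fun K₀ hK₀ hne hX F₁ F₂ t d₁ d₂ hF₁ hF₂ hm₁ hm₂ hne' hlin hread hread₂ hslice ht =>
    h K₀ hK₀ hne hX (hIH K₀ hK₀ d₁ d₂ ht) F₁ F₂ t d₁ d₂ hF₁ hF₂ hm₁ hm₂ hne' hlin hread hread₂ hslice ht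

/-- **THE CORE BOUND FROM O2 AND THE FINITE CRITERION** — strong induction on `#J₀`. -/
theorem terminalFive_of_bound (hO2 : TerminalFiveA) (hb : CleanSmallCriterionBound) : TerminalFive := by
  classical
  suffices H : ∀ (k n m r : ℕ) (I : LocalMap 4 n m), I.IsPure xorAndPred → Typed I → SimpleOverlap I → BoundaryExpanding r I →
      ∀ (y : Fin m → Bool) (J₀ : Finset (Fin m)) (w₁ w₂ : Finset (Fin n) × Finset (Fin m) × Bool), Terminal I r y J₀ w₁ w₂ →
        J₀.card = k → J₀.card ≤ 5 from
    fun n m r I hI hT hS hB y J₀ w₁ w₂ ht => H _ n m r I hI hT hS hB y J₀ w₁ w₂ ht rfl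
  intro k
  induction k using Nat.strong_induction_on with
  | _ k ih =>
    intro n m r I hI hT hS hB y J₀ w₁ w₂ ht hk
    by_cases hP : PstarChordBridgeCotree.Peelable I (nonchords I J₀)
    · -- no centre cycle: Assumption A holds, O2 applies
      obtain ⟨F, hS₀F, hFJ, hPF, hmax⟩ := exists_maximal_peelable_sup I (nonchords_subset I J₀) hP
      refine hO2 n m r I hI hT hS hB y J₀ w₁ w₂ ht F hFJ hPF hmax fun e he => ?_
      rw [mem_sdiff] at he
      by_contra hc
      exact he.2 (hS₀F ((mem_nonchords I).2 ⟨he.1, hc⟩))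
    · -- a centre cycle: two clean chords passing the criterion, by the induction hypothesis on the sub-cores
      exfalso
      obtain ⟨S, hSJ, hne, hL, hnc⟩ := exists_centre_of_not_peelable I hP
      obtain ⟨ℬ, -, hℬ, hgood⟩ := hb n m r I hI hT hS hB y J₀ w₁ w₂ ht ⟨S, hSJ, hne, hL, hnc⟩
      obtain ⟨𝒞, h𝒞J, hch, hO, hcard⟩ := exists_clean_chords hB ht
      have hU : 1 < (𝒞 \ ℬ).card := by
        have := le_card_sdiff ℬ 𝒞
        omega
      obtain ⟨a, ha, b, hb', hab⟩ := one_lt_card.1 hU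
      obtain ⟨ha𝒞, haℬ⟩ := mem_sdiff.1 ha
      obtain ⟨hb𝒞, hbℬ⟩ := mem_sdiff.1 hb'
      have hdisj : Disjoint J₀ (w₁.2.1 ∪ w₂.2.1) := disjoint_union_right.2 ⟨ht.2.2.2.1, ht.2.2.2.2.1⟩
      have hr : (J₀ ∪ (w₁.2.1 ∪ w₂.2.1)).card ≤ r := by rw [← union_assoc]; exact ht.2.2.2.2.2.1
      set 𝒢 := w₁.2.1 ∪ w₂.2.1 with h𝒢
      have hdisjI : Disjoint J₀ (internalMenu I J₀ 𝒢) := hdisj.mono_right (internalMenu_subset I J₀ 𝒢)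
      have hrI : (J₀ ∪ internalMenu I J₀ 𝒢).card ≤ r := (card_le_card (union_subset_union (Subset.refl _) (internalMenu_subset I J₀ 𝒢))).trans hr
      -- induction hypothesis: proper terminal sub-cores have at most five outputs
      have hIH : ∀ c ∈ J₀, ∀ K₀ ⊆ J₀.erase c, ∀ d₁ d₂ : Finset (Fin n) × Finset (Fin m) × Bool, Terminal I r y K₀ d₁ d₂ → K₀.card ≤ 5 := by
        intro c hc K₀ hK₀ d₁ d₂ ht₀
        have hlt : K₀.card < k := by
          rw [← hk]
          exact lt_of_le_of_lt (card_le_card hK₀) (card_erase_lt_of_mem hc)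
        exact ih K₀.card hlt n m r I hI hT hS hB y K₀ d₁ d₂ ht₀ rfl
      have hgen : ∀ c ∈ 𝒞, c ∉ ℬ → PstarChordReadLemma.SliceGeneric I y J₀ c 𝒢 := by
        intro c hc hcℬ
        obtain ⟨hA, hBc⟩ := hgood c (h𝒞J hc) hcℬ (hch c hc) (hO c hc)
        exact sliceGeneric_of_internal hI hT hS hB ht.2.2.1.le (h𝒞J hc) (hch c hc) (hO c hc)
          (sliceGeneric_of_criterionLin hI hT hS hB (h𝒞J hc) hdisjI hrI (noPathSumSubcoreLin_of_small (hIH c (h𝒞J hc)) hA) hBc)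
      exact false_of_two_clean hI hT hS hB ht (h𝒞J ha𝒞) (h𝒞J hb𝒞) hab (hch a ha𝒞) (hch b hb𝒞) (hO a ha𝒞) (hO b hb𝒞)
        (hgen a ha𝒞 haℬ) (hgen b hb𝒞 hbℬ)

/-- **O1 from the same two inputs.** -/
theorem terminalPeelable_of_bound (hO2 : TerminalFiveA) (hb : CleanSmallCriterionBound) : TerminalPeelable :=
  terminalPeelable_of_terminalFive (terminalFive_of_bound hO2 hb)

end Summit.PneNP.PneNP.Theorems.PstarTerminalFiveAssembly
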